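/-
Copyright (c) 2026. All rights reserved.
Released under Apache 2.0 license as described in the file LICENSE.
-/
import Mathlib
import HarnessLib

/-!
# Bounded difference at limit lemma

If f and g are continuous at c and |f - g| ≤ ε on a punctured neighborhood,
then |f(c) - g(c)| ≤ ε.
-/

open Complex Real Set Filter Topology Metric
open scoped Topology

noncomputable section

namespace GDecompLimitDiff

variable {f g : ℂ → ℂ} {c : ℂ} {ε : ℝ}

/-- If f and g are continuous at c and |f - g| ≤ ε on a punctured neighborhood,
    then |f(c) - g(c)| ≤ ε.

This is the key limit argument: the limit of a bounded difference is bounded. -/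
lemma bounded_diff_at_limit (_hε : 0 ≤ ε)
    (hf : ContinuousAt f c) (hg : ContinuousAt g c)
    (hδ : ∃ δ > 0, ∀ z, 0 < ‖z - c‖ → ‖z - c‖ < δ → ‖f z - g z‖ ≤ ε) :
    ‖f c - g c‖ ≤ ε := by
  have h_cont : ContinuousAt (f - g) c := hf.sub hg
  obtain ⟨δ, hδ_pos, hbound⟩ := hδ
  by_contra hne
  simp only [not_le] at hne
  set ε' := ‖f c - g c‖ - ε with hε'_def
  have hε'_pos : 0 < ε' := by linarith
  rw [Metric.continuousAt_iff] at h_cont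
  obtain ⟨δ', hδ'_pos, h_near⟩ := h_cont ε' hε'_pos
  have hmin_pos : 0 < min δ δ' := lt_min hδ_pos hδ'_pos
  have h_exists : ∃ z, 0 < ‖z - c‖ ∧ ‖z - c‖ < min δ δ' := by
    use c + (min δ δ' / 2 : ℝ)
    constructor
    · simp only [add_sub_cancel_left]
      rw [Complex.norm_real, Real.norm_eq_abs, abs_of_pos]
      · linarith
      · linarith
    · simp only [add_sub_cancel_left]
      rw [Complex.norm_real, Real.norm_eq_abs, abs_of_pos]
      · linarith
      · linarith
  obtain ⟨z, hz_pos, hz_near⟩ := h_exists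
  have h1 : ‖(f - g) z - (f - g) c‖ < ε' := by
    have := h_near (x := z)
    rw [Complex.dist_eq, Complex.dist_eq] at this
    apply this
    calc ‖z - c‖ < min δ δ' := hz_near
      _ ≤ δ' := min_le_right _ _
  have h2 : ‖(f - g) z‖ ≤ ε := by
    apply hbound z hz_pos
    calc ‖z - c‖ < min δ δ' := hz_near
      _ ≤ δ := min_le_left _ _
  have h3 : ‖(f - g) c‖ ≤ ‖(f - g) z‖ + ‖(f - g) z - (f - g) c‖ := by
    have := norm_sub_norm_le ((f - g) z) ((f - g) c)
    calc ‖(f - g) c‖ = ‖(f - g) c - (f - g) z + (f - g) z‖ := by ring_nf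
      _ ≤ ‖(f - g) c - (f - g) z‖ + ‖(f - g) z‖ := norm_add_le _ _
      _ = ‖(f - g) z - (f - g) c‖ + ‖(f - g) z‖ := by rw [norm_sub_rev]
      _ = ‖(f - g) z‖ + ‖(f - g) z - (f - g) c‖ := by ring
  have h4 : ‖(f - g) c‖ < ε + ε' := by linarith [h3, h2, h1]
  have h5 : ε + ε' = ‖f c - g c‖ := by simp only [hε'_def]; ring
  simp only [Pi.sub_apply] at h4
  linarith [h4, h5]

end GDecompLimitDiff

end
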